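import Literature.NumberTheory.Transcendental.BrownZagierCoefficients
import HarnessLib

/-!
# Brown, *Mixed Tate motives over ℤ* (2012) — Lemma 4.2 (compatibility of Zagier's coefficients
# with the coaction)

Sibling proof file of `Literature.NumberTheory.Transcendental.BrownZagierCoefficients`, in the cone
of the named fact `hoffmanSpan_eq_mzvSpace` (Brown 2012, Theorem 1.1). Brown's **Lemma 4.2**
("Proof. Exercise") is the pair of binomial identities which make Zagier's formula (Theorem 4.1)
compatible with the coaction, i.e. the induction step of its motivic lift (Theorem 4.3): for
`a, b ≥ 0` and `1 ≤ r ≤ a + b + 1`, summing over `α, β ≥ 0` with `α + β + 1 = r`,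

* `∑_{α ≤ a, β ≤ b} A^r_{α,β} - ∑_{α ≤ a, β < b} A^r_{β,α} + I(b ≥ r) - I(a ≥ r) = A^r_{a,b}`
  (`Brown2012.lemma_4_2_A`),
* `∑_{α ≤ a, β ≤ b} B^r_{α,β} - ∑_{α ≤ a, β < b} B^r_{β,α} = B^r_{a,b}` (`Brown2012.lemma_4_2_B`),

where `A^r_{a,b} = C(2r, 2a+2) = zagierA r a` and `B^r_{a,b} = (1 - 2^{-2r}) C(2r, 2b+1) = zagierB r b`
(so `A^r_{α,β} = zagierA r α`, `A^r_{β,α} = zagierA r β`, `B^r_{α,β} = zagierB r β`,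
`B^r_{β,α} = zagierB r α`). The sums over pairs `(α, β)` with `α + β + 1 = r` are written as sums
over `α ∈ {0, …, r-1}` with `β = r - 1 - α`. Proofs (Brown's hint): the symmetries
`A^{α+β+1}_{α,β} = A^{α+β+1}_{β-1,α+1}` and `B^{α+β+1}_{α,β} = B^{α+β+1}_{β,α}`, i.e.
`C(2r, 2β+2) = C(2r, 2α)` and `C(2r, 2α+1) = C(2r, 2β+1)`, after which (B) reduces to the single
term `β = b` and (A) telescopes.

No definitions and no named facts are introduced (pure proofs, D-0026).

## References

* F. Brown, *Mixed Tate motives over ℤ*, Ann. of Math. **175** (2012), 949–976, §4.1 Lemma 4.2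
  (arXiv:1102.1312, p. 11). [Brown2012]
-/

namespace Literature.NumberTheory.Transcendental

namespace Brown2012

open Finset

/-- The symmetry `B^r_{β,α} = B^r_{α,β}` on the line `α + β + 1 = r`:
`C(2r, 2α+1) = C(2r, 2(r-1-α)+1)` for `α < r`. [cite: Brown2012, proof of Lemma 4.2] -/
theorem zagierB_symm_line {r α : ℕ} (h : α < r) : zagierB r α = zagierB r (r - 1 - α) := by
  rw [zagierB_def, zagierB_def, Nat.choose_symm_of_eq_add (a := 2 * α + 1)
    (b := 2 * (r - 1 - α) + 1) (by omega)]

/-- The symmetry `A^r_{β,α} = A^r_{β-1+1, …}`: `C(2r, 2(r-1-α)+2) = C(2r, 2α)` for `α < r`.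
[cite: Brown2012, proof of Lemma 4.2] -/
theorem zagierA_symm_line {r α : ℕ} (h : α < r) :
    zagierA r (r - 1 - α) = (Nat.choose (2 * r) (2 * α) : ℚ) := by
  rw [zagierA_def, Nat.choose_symm_of_eq_add (a := 2 * (r - 1 - α) + 2) (b := 2 * α) (by omega)]

/-- **Brown 2012, Lemma 4.2, second identity**: for `1 ≤ r ≤ a + b + 1` (the hypothesis `1 ≤ r`
is not needed), `∑_{α ≤ a, β ≤ b, α+β+1=r} B^r_{α,β} - ∑_{α ≤ a, β < b, α+β+1=r} B^r_{β,α} = B^r_{a,b}`.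
[cite: Brown2012, Lemma 4.2] -/
theorem lemma_4_2_B (a b r : ℕ) (hr' : r ≤ a + b + 1) :
    ∑ α ∈ (Finset.range r).filter (fun α => α ≤ a ∧ r - 1 - α ≤ b), zagierB r (r - 1 - α) -
        ∑ α ∈ (Finset.range r).filter (fun α => α ≤ a ∧ r - 1 - α < b), zagierB r α =
      zagierB r b := by
  -- symmetry in the second sum
  have h2 : ∑ α ∈ (Finset.range r).filter (fun α => α ≤ a ∧ r - 1 - α < b), zagierB r α =
      ∑ α ∈ (Finset.range r).filter (fun α => α ≤ a ∧ r - 1 - α < b), zagierB r (r - 1 - α) :=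
    Finset.sum_congr rfl fun α hα =>
      zagierB_symm_line (Finset.mem_range.1 (Finset.mem_filter.1 hα).1)
  rw [h2]
  -- split the first index set into `β < b` and `β = b`
  have hsplit : (Finset.range r).filter (fun α => α ≤ a ∧ r - 1 - α ≤ b) =
      (Finset.range r).filter (fun α => α ≤ a ∧ r - 1 - α < b) ∪
        (Finset.range r).filter (fun α => α ≤ a ∧ r - 1 - α = b) := by
    ext α
    simp only [Finset.mem_filter, Finset.mem_range, Finset.mem_union]
    omega
  have hdisj : Disjoint ((Finset.range r).filter (fun α => α ≤ a ∧ r - 1 - α < b))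
      ((Finset.range r).filter (fun α => α ≤ a ∧ r - 1 - α = b)) := by
    rw [Finset.disjoint_filter]
    intro α _ h1 h2
    omega
  rw [hsplit, Finset.sum_union hdisj, add_sub_cancel_left]
  by_cases hb : b + 1 ≤ r
  · have hset : (Finset.range r).filter (fun α => α ≤ a ∧ r - 1 - α = b) = {r - 1 - b} := by
      ext α
      simp only [Finset.mem_filter, Finset.mem_range, Finset.mem_singleton]
      omega
    rw [hset, Finset.sum_singleton, show r - 1 - (r - 1 - b) = b by omega]
  · have hset : (Finset.range r).filter (fun α => α ≤ a ∧ r - 1 - α = b) = ∅ := by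
      ext α
      simp only [Finset.mem_filter, Finset.mem_range, Finset.notMem_empty, iff_false]
      omega
    rw [hset, Finset.sum_empty, zagierB_def, Nat.choose_eq_zero_of_lt (by omega)]
    simp

/-- Sums over an interval `Icc L U ⊆ ℕ` as sums over `range`. [folklore] -/
theorem sum_Icc_eq_sum_range' (h : ℕ → ℚ) (L U : ℕ) :
    ∑ α ∈ Finset.Icc L U, h α = ∑ i ∈ Finset.range (U + 1 - L), h (L + i) := by
  rw [← Finset.sum_Ico_eq_sum_range, show Finset.Icc L U = Finset.Ico L (U + 1) by
    ext α; simp only [Finset.mem_Icc, Finset.mem_Ico]; omega]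

/-- **Brown 2012, Lemma 4.2, first identity**: for `1 ≤ r ≤ a + b + 1`,
`∑_{α ≤ a, β ≤ b, α+β+1=r} A^r_{α,β} - ∑_{α ≤ a, β < b, α+β+1=r} A^r_{β,α} + I(b ≥ r) - I(a ≥ r)
= A^r_{a,b}`. [cite: Brown2012, Lemma 4.2] -/
theorem lemma_4_2_A (a b r : ℕ) (hr : 1 ≤ r) (hr' : r ≤ a + b + 1) :
    ∑ α ∈ (Finset.range r).filter (fun α => α ≤ a ∧ r - 1 - α ≤ b), zagierA r α -
        ∑ α ∈ (Finset.range r).filter (fun α => α ≤ a ∧ r - 1 - α < b), zagierA r (r - 1 - α) +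
        (if r ≤ b then 1 else 0) - (if r ≤ a then 1 else 0) =
      zagierA r a := by
  -- the function `g k = C(2r, 2k)`: `A^r_{α,·} = g (α + 1)`, and `A^r_{β,α} = g α` by symmetry
  set g : ℕ → ℚ := fun k => (Nat.choose (2 * r) (2 * k) : ℚ) with hg
  have hA : ∀ α, zagierA r α = g (α + 1) := fun α => by
    rw [zagierA_def, hg, show 2 * α + 2 = 2 * (α + 1) by ring]
  have h1 : ∑ α ∈ (Finset.range r).filter (fun α => α ≤ a ∧ r - 1 - α ≤ b), zagierA r α =
      ∑ α ∈ (Finset.range r).filter (fun α => α ≤ a ∧ r - 1 - α ≤ b), g (α + 1) :=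
    Finset.sum_congr rfl fun α _ => hA α
  have h2 : ∑ α ∈ (Finset.range r).filter (fun α => α ≤ a ∧ r - 1 - α < b), zagierA r (r - 1 - α) =
      ∑ α ∈ (Finset.range r).filter (fun α => α ≤ a ∧ r - 1 - α < b), g α :=
    Finset.sum_congr rfl fun α hα =>
      zagierA_symm_line (Finset.mem_range.1 (Finset.mem_filter.1 hα).1)
  rw [h1, h2, hA a]
  -- the index sets are intervals
  set U := min a (r - 1) with hU
  have hF1 : (Finset.range r).filter (fun α => α ≤ a ∧ r - 1 - α ≤ b) = Finset.Icc (r - 1 - b) U := by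
    ext α
    simp only [Finset.mem_filter, Finset.mem_range, Finset.mem_Icc, hU]
    omega
  have hF2 : (Finset.range r).filter (fun α => α ≤ a ∧ r - 1 - α < b) = Finset.Icc (r - b) U := by
    ext α
    simp only [Finset.mem_filter, Finset.mem_range, Finset.mem_Icc, hU]
    omega
  rw [hF1, hF2]
  -- the common last step: `g (U+1) - I(a ≥ r) = g (a+1)`
  have hend : g (U + 1) - (if r ≤ a then 1 else 0) = g (a + 1) := by
    by_cases ha : r ≤ a
    · rw [if_pos ha, hU, min_eq_right (by omega), hg]
      simp only
      rw [show 2 * (r - 1 + 1) = 2 * r by omega, Nat.choose_self, Nat.choose_eq_zero_of_lt (by omega)]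
      simp
    · rw [if_neg ha, hU, min_eq_left (by omega), sub_zero]
  have hLU : r - 1 - b ≤ U := by rw [hU]; omega
  by_cases hb : r ≤ b
  · -- `b ≥ r`: both sums run over `0 ≤ α ≤ U` and telescope to `g (U+1) - g 0 = g (U+1) - 1`
    rw [if_pos hb, show r - 1 - b = 0 by omega, show r - b = 0 by omega,
      sum_Icc_eq_sum_range', sum_Icc_eq_sum_range', Nat.sub_zero]
    simp only [zero_add]
    have htel := Finset.sum_range_sub g (U + 1)
    rw [Finset.sum_sub_distrib] at htel
    have hg0 : g 0 = 1 := by rw [hg]; simp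
    linear_combination htel + hend - hg0
  · -- `b < r`: the second interval is the first shifted by one, minus nothing: difference `g (U+1)`
    rw [if_neg hb, show r - b = r - 1 - b + 1 by omega, sum_Icc_eq_sum_range', sum_Icc_eq_sum_range',
      show U + 1 - (r - 1 - b) = U - (r - 1 - b) + 1 by omega, Finset.sum_range_succ,
      show U + 1 - (r - 1 - b + 1) = U - (r - 1 - b) by omega,
      show r - 1 - b + (U - (r - 1 - b)) + 1 = U + 1 by omega]
    have hshift : ∑ i ∈ Finset.range (U - (r - 1 - b)), g (r - 1 - b + i + 1) =
        ∑ i ∈ Finset.range (U - (r - 1 - b)), g (r - 1 - b + 1 + i) :=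
      Finset.sum_congr rfl fun i _ => by rw [show r - 1 - b + i + 1 = r - 1 - b + 1 + i by ring]
    linear_combination hshift + hend

end Brown2012

end Literature.NumberTheory.Transcendental
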